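import Literature.Topology.FourManifolds.SimplifiedBrokenLefschetzSphereSideTube
import HarnessLib

/-!
# Four-sphere recognition from a slice-preserving genus-one gluing, I: the boundary carriers
# — helpers for stub `stub_sliceRecognition` of line `Sketch`, crux `SblfDescent.RungOne`

(Crux item stmt-SmoothPoincare4-18531; skeleton `Cruxes/RungOne/Lines/Sketch.lean`.)

The stub `stub_sliceRecognition` recognises the 4-sphere from a gluing `X = W₀ ∪_φ V₀` of the
two tubes of the genus-one splitting of the level sphere `S = {Σ xᵢ² = 1} ⊆ ℝ⁵`
(`SphereFourSplitting`, `SphereFourGenusOneSplitting.lean`: `W₀ = {x₃² + x₄² ≤ 1/2} ≅ S² × D²`,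
`V₀ = {x₃² + x₄² ≥ 1/2} ≅ S¹ × B³`) along a diffeomorphism `φ : ∂W₀ ≅ ∂V₀` preserving the
coordinates `x₃, x₄`.  This first helper file is the plumbing of the two boundary carriers
`∂W₀`, `∂V₀` (the subtypes of boundary points of the regular domains, with the tree's boundary
manifold structure `BoundaryManifold.chartedSpace`), read through the inverse parametrisation
`x ↦ (θ(x), w(x)) ∈ S² × ℝ²` of `W₀` (`SphereFourSplitting.invHead`, `invTail`,
`SimplifiedBrokenLefschetzSphereSideTube.lean`, §2); on the common boundary
`{x₃² + x₄² = 1/2}` one has `x = (θ/√2, w)` with `|w|² = 1/2`: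

* smooth maps INTO the level sphere, the polar tube and the two boundary carriers from smooth
  ambient data (`exists_lift_levelSphere`, `exists_lift_polarTube`, `exists_lift_boundaryW`,
  `exists_lift_boundaryV`; Lee 2013, Cor. 5.30, through the tree's
  `HalfSliceAtlas.contMDiff_codRestrict` and `BoundaryManifold.contMDiff_codRestrict`);
* points of the carriers are determined by `(θ, w)` (`boundaryW_ext`, `boundaryV_ext`, the
  registered helper `helper_sliceRec_carriers`);
* smoothness OUT of the carriers of `θ`, `w` and the norm identity `|w|² = 1/2`.

Everything is proved; no definitions, no named facts, no local notation.

## References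

* J. M. Lee, *Introduction to Smooth Manifolds* (2013), Cor. 5.30. [LeeSmoothManifolds2013]
* J. Milnor, *Morse theory* (1963), Thm. 3.1 (regular domains `{f ≤ a}`). [Milnor1963]
-/

-- the prescribed namespace `Summit.<P>.<Sub>.…` duplicates `SmoothPoincare4` (P = Sub)
set_option linter.dupNamespace false

noncomputable section

open scoped Manifold ContDiff Topology
open Set Function Literature.Topology.FourManifolds SphereFourSplitting

namespace Summit.SmoothPoincare4.SmoothPoincare4.Cruxes.RungOne.Sketch

/-! ### Smooth maps into the level sphere and the polar tube -/

section Lifts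

variable {E' H' : Type*} [NormedAddCommGroup E'] [NormedSpace ℝ E'] [TopologicalSpace H']
  {J : ModelWithCorners ℝ E' H'} {N : Type*} [TopologicalSpace N] [ChartedSpace H' N]

/-- **Smooth maps into the level sphere `S`**: a smooth map into `ℝ⁵` with values on the unit
sphere is a smooth map into `S` (through `S ≅ 𝕊⁴`, `sphereLevelDiffeomorph`, and Mathlib's
`ContMDiff.codRestrict_sphere`). [cite: LeeSmoothManifolds2013, Cor. 5.30] -/
theorem exists_lift_levelSphere [IsManifold J ∞ N] (f : N → EuclideanSpace ℝ (Fin 5))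
    (hf : ContMDiff J 𝓘(ℝ, EuclideanSpace ℝ (Fin 5)) ∞ f) (h1 : ∀ n, sqNorm (f n) = 1) :
    ∃ F : N → LevelSphere, ContMDiff J (𝓡 4) ∞ F ∧ ∀ n, ι (F n) = f n := by
  haveI := fact_finrank_euclideanSpace_succ 4
  have hmem : ∀ n, f n ∈ Metric.sphere (0 : EuclideanSpace ℝ (Fin 5)) 1 := by
    intro n
    have h := h1 n
    rw [sqNorm_eq_norm_sq] at h
    rw [mem_sphere_zero_iff_norm]
    nlinarith [norm_nonneg (f n)]
  refine ⟨fun n => sphereLevelDiffeomorph.symm (Set.codRestrict f _ hmem n), ?_, fun n => ?_⟩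
  · exact sphereLevelDiffeomorph.symm.contMDiff.comp (hf.codRestrict_sphere hmem)
  · have h := coe_sphereLevelDiffeomorph (sphereLevelDiffeomorph.symm (Set.codRestrict f _ hmem n))
    rw [Diffeomorph.apply_symm_apply] at h
    exact h.symm

/-- **Smooth maps into the polar tube `V₀`**: a smooth map into `ℝ⁵` with values on the unit
sphere and `x₃² + x₄² ≥ 1/2` is a smooth map into `V₀` (Lee 2013, Cor. 5.30, via
`HalfSliceAtlas.contMDiff_codRestrict`). [cite: LeeSmoothManifolds2013, Cor. 5.30] -/
theorem exists_lift_polarTube [IsManifold J ∞ N] (f : N → EuclideanSpace ℝ (Fin 5))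
    (hf : ContMDiff J 𝓘(ℝ, EuclideanSpace ℝ (Fin 5)) ∞ f) (h1 : ∀ n, sqNorm (f n) = 1)
    (h2 : ∀ n, 1 / 2 ≤ tubeFn (f n)) :
    ∃ F : N → PolarTube, ContMDiff J (𝓡∂ 4) ∞ F ∧ ∀ n, ι (ιV (F n)) = f n := by
  obtain ⟨F₀, hF₀, hF₀f⟩ := exists_lift_levelSphere f hf h1
  have hmem : ∀ n, F₀ n ∈ (fun q : LevelSphere => 1 / 2 - tubeS q) ⁻¹' Iic 0 := by
    intro n
    show 1 / 2 - tubeS (F₀ n) ≤ 0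
    have : tubeS (F₀ n) = tubeFn (f n) := by rw [tubeS, hF₀f]
    rw [this]
    linarith [h2 n]
  exact ⟨Set.codRestrict F₀ _ hmem,
    (RegularSublevel.halfSliceAtlas hPolar).contMDiff_codRestrict hmem hF₀, fun n => hF₀f n⟩

/-- On the sphere of radius `1/√2`, the scale factor `c(w) = 1/√(1 + 2|w|²)` is `1/√2`.
[folklore] -/
theorem scale_eq_of_sq2_eq {w : EuclideanSpace ℝ (Fin 2)} (hw : sq2 w = 1 / 2) :
    scale w = (Real.sqrt 2)⁻¹ := by
  rw [scale, hw]
  norm_num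

/-- The tube function along the model parametrisation at `|w|² = 1/2` is `1/2`. [folklore] -/
theorem tubeS_tubeParamS_of_sq2_eq (θ : Metric.sphere (0 : EuclideanSpace ℝ (Fin 3)) 1)
    {w : EuclideanSpace ℝ (Fin 2)} (hw : sq2 w = 1 / 2) :
    tubeS (tubeParamS (θ, w)) = 1 / 2 := by
  rw [tubeS_tubeParamS]
  have hc := scale_sq_mul w
  simp only at hc ⊢
  rw [hw] at hc ⊢
  nlinarith

/-- **Smooth maps into the boundary carrier `∂W₀`** from smooth sphere data `(θ, w)`,
`|w|² = 1/2`: the point `(θ/√2, w)` of the common boundary, as a smooth map into the boundary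
manifold of `W₀`, with `θ(·) = θ`, `w(·) = w` (Lee 2013, Cor. 5.30, through
`HalfSliceAtlas.contMDiff_codRestrict` and `BoundaryManifold.contMDiff_codRestrict`).
[cite: LeeSmoothManifolds2013, Cor. 5.30] -/
theorem exists_lift_boundaryW (θ : N → Metric.sphere (0 : EuclideanSpace ℝ (Fin 3)) 1)
    (w : N → EuclideanSpace ℝ (Fin 2)) (hθ : ContMDiff J (𝓡 2) ∞ θ)
    (hw : ContMDiff J 𝓘(ℝ, EuclideanSpace ℝ (Fin 2)) ∞ w) (hn : ∀ n, sq2 (w n) = 1 / 2) :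
    ∃ F : N → (𝓡∂ 4).boundary EquatorTube, ContMDiff J (𝓡 3) ∞ F ∧
      ∀ n, invHead (F n).1 = θ n ∧ invTail (F n).1 = w n := by
  have hmem : ∀ n, tubeParamS (θ n, w n) ∈ tubeS ⁻¹' Iic (1 / 2 : ℝ) := fun n =>
    show tubeS (tubeParamS (θ n, w n)) ≤ 1 / 2 from (tubeS_tubeParamS_of_sq2_eq (θ n) (hn n)).le
  set F₁ : N → EquatorTube := Set.codRestrict (fun n => tubeParamS (θ n, w n)) _ hmem with hF₁
  have hF₁s : ContMDiff J (𝓡∂ 4) ∞ F₁ :=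
    (RegularSublevel.halfSliceAtlas isRegularLevel_tubeS).contMDiff_codRestrict hmem
      (contMDiff_tubeParamS.comp (hθ.prodMk hw))
  have hbd : ∀ n, F₁ n ∈ (𝓡∂ 4).boundary EquatorTube := fun n =>
    (RegularSublevel.mem_boundary_iff isRegularLevel_tubeS (F₁ n)).2
      (tubeS_tubeParamS_of_sq2_eq (θ n) (hn n))
  refine ⟨Set.codRestrict F₁ _ hbd, BoundaryManifold.contMDiff_codRestrict hbd hF₁s, fun n => ?_⟩
  have h := invParam_mk_tubeParamS (θ n, w n) (hmem n)
  exact ⟨congrArg Prod.fst h, congrArg Prod.snd h⟩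

/-- **Smooth maps into the boundary carrier `∂V₀`** from smooth sphere data `(θ, w)`,
`|w|² = 1/2` (as `exists_lift_boundaryW`, the point being read in `∂W₀` through the
identification `∂W₀ ≡ ∂V₀`, `RegularSublevel.splitDiffeomorph`, the identity on points).
[cite: LeeSmoothManifolds2013, Cor. 5.30] -/
theorem exists_lift_boundaryV (θ : N → Metric.sphere (0 : EuclideanSpace ℝ (Fin 3)) 1)
    (w : N → EuclideanSpace ℝ (Fin 2)) (hθ : ContMDiff J (𝓡 2) ∞ θ)
    (hw : ContMDiff J 𝓘(ℝ, EuclideanSpace ℝ (Fin 2)) ∞ w) (hn : ∀ n, sq2 (w n) = 1 / 2) :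
    ∃ F : N → (𝓡∂ 4).boundary PolarTube, ContMDiff J (𝓡 3) ∞ F ∧
      ∀ n, invHead ((RegularSublevel.splitDiffeomorph isRegularLevel_tubeS).symm (F n)).1 = θ n ∧
        invTail ((RegularSublevel.splitDiffeomorph isRegularLevel_tubeS).symm (F n)).1 = w n := by
  have hmem : ∀ n, tubeParamS (θ n, w n) ∈ (fun q : LevelSphere => 1 / 2 - tubeS q) ⁻¹' Iic 0 :=
    fun n => show 1 / 2 - tubeS (tubeParamS (θ n, w n)) ≤ 0 by
      rw [tubeS_tubeParamS_of_sq2_eq (θ n) (hn n)]; norm_num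
  set F₁ : N → PolarTube := Set.codRestrict (fun n => tubeParamS (θ n, w n)) _ hmem with hF₁
  have hF₁s : ContMDiff J (𝓡∂ 4) ∞ F₁ :=
    (RegularSublevel.halfSliceAtlas hPolar).contMDiff_codRestrict hmem
      (contMDiff_tubeParamS.comp (hθ.prodMk hw))
  have hbd : ∀ n, F₁ n ∈ (𝓡∂ 4).boundary PolarTube := fun n =>
    (RegularSublevel.mem_boundary_iff hPolar (F₁ n)).2
      (show 1 / 2 - tubeS (tubeParamS (θ n, w n)) = 0 by
        rw [tubeS_tubeParamS_of_sq2_eq (θ n) (hn n)]; norm_num)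
  refine ⟨Set.codRestrict F₁ _ hbd, BoundaryManifold.contMDiff_codRestrict hbd hF₁s, fun n => ?_⟩
  have hmem' : tubeS (tubeParamS (θ n, w n)) ≤ 1 / 2 := (tubeS_tubeParamS_of_sq2_eq (θ n) (hn n)).le
  have h := invParam_mk_tubeParamS (θ n, w n) hmem'
  exact ⟨congrArg Prod.fst h, congrArg Prod.snd h⟩

end Lifts

/-! ### Points of the carriers are determined by `(θ, w)`; smoothness of `θ`, `w` -/

/-- **Points of `∂W₀` are determined by `(θ, w)`** (`Π_S ∘ (θ, w) = id` on `W₀`,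
`tubeParamS_invParam`, and injectivity of the inclusions). [folklore] -/
theorem boundaryW_ext (z z' : (𝓡∂ 4).boundary EquatorTube) (hh : invHead z.1 = invHead z'.1)
    (ht : invTail z.1 = invTail z'.1) : z = z' := by
  have hp : invParam z.1 = invParam z'.1 := Prod.ext hh ht
  have h1 : ιW z.1 = ιW z'.1 := by rw [← tubeParamS_invParam, hp, tubeParamS_invParam]
  exact Subtype.ext (RegularSublevel.injective_incl isRegularLevel_tubeS h1)

/-- **Points of `∂V₀` are determined by `(θ, w)`** (read through `∂W₀ ≡ ∂V₀`). This is the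
registered helper `helper_sliceRec_carriers`. [folklore] -/
theorem helper_sliceRec_carriers : ∀ z z' : (𝓡∂ 4).boundary PolarTube, invHead ((RegularSublevel.splitDiffeomorph isRegularLevel_tubeS).symm z).1 = invHead ((RegularSublevel.splitDiffeomorph isRegularLevel_tubeS).symm z').1 → invTail ((RegularSublevel.splitDiffeomorph isRegularLevel_tubeS).symm z).1 = invTail ((RegularSublevel.splitDiffeomorph isRegularLevel_tubeS).symm z').1 → z = z' := by
  intro z z' hh ht
  exact (RegularSublevel.splitDiffeomorph isRegularLevel_tubeS).symm.injective
    (boundaryW_ext _ _ hh ht)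

/-- `Subtype.val : ∂W₀ → W₀` is smooth (`BoundaryManifold.isSmoothEmbedding_subtype_val`).
[folklore] -/
theorem contMDiff_val_boundaryW :
    ContMDiff (𝓡 3) (𝓡∂ 4) ∞ (Subtype.val : (𝓡∂ 4).boundary EquatorTube → EquatorTube) :=
  (BoundaryManifold.isSmoothEmbedding_subtype_val (n := 3) (W := EquatorTube)).contMDiff

/-- `Subtype.val : ∂V₀ → V₀` is smooth. [folklore] -/
theorem contMDiff_val_boundaryV :
    ContMDiff (𝓡 3) (𝓡∂ 4) ∞ (Subtype.val : (𝓡∂ 4).boundary PolarTube → PolarTube) :=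
  (BoundaryManifold.isSmoothEmbedding_subtype_val (n := 3) (W := PolarTube)).contMDiff

/-- `z ↦ θ(z) : ∂W₀ → S²` is smooth. [folklore] -/
theorem contMDiff_invHead_boundaryW :
    ContMDiff (𝓡 3) (𝓡 2) ∞ fun z : (𝓡∂ 4).boundary EquatorTube => invHead z.1 :=
  contMDiff_invHead.comp contMDiff_val_boundaryW

/-- `z ↦ w(z) : ∂W₀ → ℝ²` is smooth. [folklore] -/
theorem contMDiff_invTail_boundaryW :
    ContMDiff (𝓡 3) 𝓘(ℝ, EuclideanSpace ℝ (Fin 2)) ∞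
      fun z : (𝓡∂ 4).boundary EquatorTube => invTail z.1 :=
  contMDiff_invTail.comp contMDiff_val_boundaryW

/-- `z ↦ θ(z) : ∂V₀ → S²` (through `∂W₀ ≡ ∂V₀`) is smooth. [folklore] -/
theorem contMDiff_invHead_boundaryV :
    ContMDiff (𝓡 3) (𝓡 2) ∞ fun z : (𝓡∂ 4).boundary PolarTube =>
      invHead ((RegularSublevel.splitDiffeomorph isRegularLevel_tubeS).symm z).1 :=
  contMDiff_invHead_boundaryW.comp (RegularSublevel.splitDiffeomorph isRegularLevel_tubeS).symm.contMDiff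

/-- `z ↦ w(z) : ∂V₀ → ℝ²` (through `∂W₀ ≡ ∂V₀`) is smooth. [folklore] -/
theorem contMDiff_invTail_boundaryV :
    ContMDiff (𝓡 3) 𝓘(ℝ, EuclideanSpace ℝ (Fin 2)) ∞ fun z : (𝓡∂ 4).boundary PolarTube =>
      invTail ((RegularSublevel.splitDiffeomorph isRegularLevel_tubeS).symm z).1 :=
  contMDiff_invTail_boundaryW.comp (RegularSublevel.splitDiffeomorph isRegularLevel_tubeS).symm.contMDiff

/-- On `∂W₀` the radial factor is `r = 1/√2`. [folklore] -/
theorem rad_boundaryW (z : (𝓡∂ 4).boundary EquatorTube) : rad z.1 = (Real.sqrt 2)⁻¹ := by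
  have h : tubeS (ιW z.1) = 1 / 2 := RegularSublevel.apply_incl_boundary isRegularLevel_tubeS z
  rw [rad, h]
  norm_num

/-- On `∂W₀`, `|w(z)|² = 1/2`. [folklore] -/
theorem sq2_invTail_boundaryW (z : (𝓡∂ 4).boundary EquatorTube) : sq2 (invTail z.1) = 1 / 2 := by
  have h : tubeS (ιW z.1) = 1 / 2 := RegularSublevel.apply_incl_boundary isRegularLevel_tubeS z
  have hm := sq2_invTail_mul z.1
  have hr : rad z.1 ^ 2 = 1 / 2 := by rw [rad_sq, h]; norm_num
  rw [hr, h] at hm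
  linarith

/-- On `∂V₀`, `|w(z)|² = 1/2`. [folklore] -/
theorem sq2_invTail_boundaryV (z : (𝓡∂ 4).boundary PolarTube) :
    sq2 (invTail ((RegularSublevel.splitDiffeomorph isRegularLevel_tubeS).symm z).1) = 1 / 2 :=
  sq2_invTail_boundaryW _

/-- The unit tail `√2 · w(z)` of a point of `∂W₀` lies on the unit circle. [folklore] -/
theorem sqrt_two_smul_invTail_mem_sphere (z : (𝓡∂ 4).boundary EquatorTube) :
    Real.sqrt 2 • invTail z.1 ∈ Metric.sphere (0 : EuclideanSpace ℝ (Fin 2)) 1 := by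
  rw [mem_sphere_zero_iff_norm, norm_smul, Real.norm_eq_abs, abs_of_nonneg (Real.sqrt_nonneg 2)]
  have h := sq2_invTail_boundaryW z
  rw [sq2_eq_norm_sq] at h
  have hn : ‖invTail z.1‖ = (Real.sqrt 2)⁻¹ := by
    have h2 : ((Real.sqrt 2)⁻¹) ^ 2 = 1 / 2 := by
      rw [inv_pow, Real.sq_sqrt zero_le_two]; norm_num
    nlinarith [norm_nonneg (invTail z.1), inv_pos.2 (Real.sqrt_pos.2 two_pos), h, h2,
      sq_nonneg (‖invTail z.1‖ - (Real.sqrt 2)⁻¹), sq_nonneg (‖invTail z.1‖ + (Real.sqrt 2)⁻¹)]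
  rw [hn, mul_inv_cancel₀ (Real.sqrt_ne_zero'.2 two_pos)]

/-- **Ambient coordinates of a point of `∂W₀`**: `x = (θ/√2, w)`, i.e. `x = Π(θ(x), w(x))`
with scale factor `1/√2`. [folklore] -/
theorem ι_boundaryW (z : (𝓡∂ 4).boundary EquatorTube) :
    ι (ιW z.1) = tubeParam (invHead z.1, invTail z.1) ∧ scale (invTail z.1) = (Real.sqrt 2)⁻¹ :=
  ⟨(tubeParam_invParam z.1).symm, scale_eq_of_sq2_eq (sq2_invTail_boundaryW z)⟩

/-- `V₀ → ℝ⁵` is smooth. [folklore] -/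
theorem contMDiff_ι_ιV : ContMDiff (𝓡∂ 4) 𝓘(ℝ, EuclideanSpace ℝ (Fin 5)) ∞
    fun q : PolarTube => ι (ιV q) :=
  (RegularLevel.contMDiff_incl isRegularLevel_sqNorm).comp (RegularSublevel.contMDiff_incl hPolar)

/-- Points of `V₀` are determined by their ambient coordinates. [folklore] -/
theorem polarTube_ext (q q' : PolarTube) (h : ι (ιV q) = ι (ιV q')) : q = q' :=
  RegularSublevel.injective_incl hPolar
    ((RegularLevel.isEmbedding_incl isRegularLevel_sqNorm).injective h)

/-- A point of `V₀` is a boundary point iff `x₃² + x₄² = 1/2`. [folklore] -/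
theorem mem_boundary_polarTube_iff (q : PolarTube) :
    q ∈ (𝓡∂ 4).boundary PolarTube ↔ tubeFn (ι (ιV q)) = 1 / 2 := by
  rw [RegularSublevel.mem_boundary_iff hPolar q]
  show 1 / 2 - tubeS (ιV q) = 0 ↔ tubeFn (ι (ιV q)) = 1 / 2
  rw [tubeS, sub_eq_zero]
  exact eq_comm

/-- The ambient point of `z ∈ ∂V₀` is that of the corresponding point of `∂W₀` (the
identification `∂W₀ ≡ ∂V₀` is the identity on points). [folklore] -/
theorem ι_ιV_boundaryV (z : (𝓡∂ 4).boundary PolarTube) :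
    ι (ιV z.1) = ι (ιW ((RegularSublevel.splitDiffeomorph isRegularLevel_tubeS).symm z).1) := rfl

end Summit.SmoothPoincare4.SmoothPoincare4.Cruxes.RungOne.Sketch

end
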